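import Summits.BirchSwinnertonDyer.BirchSwinnertonDyer.Theorems.Rank1ResidualX10MainConjecture
import Literature.NumberTheory.EllipticCurves.Rank1Residual.X10OrdinaryTowerProofs
import Literature.NumberTheory.EllipticCurves.Greenberg1999.RankZeroEulerCharacteristicOddPrimeProofs
import HarnessLib

/-!
# X10a′ ∩ {r = 0}: the four `MazurMainConjecture W 3` theorems of `Rank1ResidualX10MainConjecture.lean` with TWO binders swapped for theorems (cell `b2b-bsdres`, unit `b2b-bsdres-x10`, gen 13)

HONEST FRAMING (run/shared/lean/b2b/bsd-rank1-residual/, verbatim in every file): the goal of the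
cell is to DELETE the COMBINATION-SHAPED residual classes of the Birch–Swinnerton-Dyer formula for
ALL analytic-rank `≤ 1` elliptic curves over `ℚ` — "full BSD formula for every rank `≤ 1` curve in
class `C`" assembled STRICTLY from published theorems — so that the rank-`≤ 1` remainder becomes
exactly the CONSTRUCTION-SHAPED classes, which are TYPED (missing-input `Prop`s), NOT attempted.
This is not "finishing BSD". Theorems only (no definition, no named fact); binder bookkeeping; NOTHING
is booked; no class label changes.

The gen-5 file `Theorems/Rank1ResidualX10MainConjecture.lean` (this unit) takes, among its displayed
named facts, (a) Wuthrich 2014 Lemma 20 `hW20 : lemma20_surjective_threeAdic_of_semistable` (registry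
A9) — used ONLY to get `ρ̄_{E,3ⁿ}` surjective for all `n` on X10a′ — and (b) Greenberg 1999 Thm. 4.1
`hGr : greenberg_charValue_rankZero` (registry A23). Both are now THEOREMS of the tree from smaller
inputs: (a) lit-kato gen 7, `Rank1Residual/X10OrdinaryTowerProofs.lean` (p247891):
`X10.towerSurj_of_surj : ClassX10 W 3 → Surj W 3 → ∀ n, Surj_{3ⁿ}` (Serre–Tate line at a good ORDINARY
`3`; no Lemma-20 binder); (b) lit-su gen 8, `Greenberg1999/RankZeroEulerCharacteristicOddPrimeProofs.lean`
(p247807): `greenberg_charValue_rankZero_of_Schneider1985_odd hS hMT` from Schneider 1985 / BMS 2016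
Thm. 1.7 at odd `p` (`Schneider1985_order_charGenerator_odd`, A35) and the Mazur–Stein–Tate `σ`-function
at odd `p` (`mazur_tate_sigma_exists_odd`, A34) — registry row A23 is DERIVED from A35 + A34. This file
restates the four theorems with `hW20` DROPPED and `hGr` REPLACED by `(hS, hMT)`; statements otherwise
verbatim, proofs = the gen-5 Literature theorems `mainConjecture_iff_bsdp_of_kato` /
`mainConjecture_iff_missingLowerBoundAt_of_kato` fed with `X10.towerSurj_of_surj`. Net for a reader of
X10a′ ∩ {r = 0}: the displayed PUBLISHED inputs are Kato 17.4 (3) (`hK`), modularity (`hmod`), GZK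
(`hGZK`), Schneider/BMS odd (`hS`), MST σ odd (`hMT`), the inline period unit (`hϖ`) — and no A9.

References: [Kato2004Asterisque] Thm. 17.4 (3) (p. 273); [GreenbergLNM1716] Thm. 4.1;
[BalakrishnanMullerStein2015] Thm. 1.7; [MazurSteinTate2006] Thm. 1.3; [Wuthrich2014] Lemma 20, Prop. 21;
[Miller2011LMS] Def. 1.1; cell INBOX 2026-08-21T04:26Z (lit-kato gen 7), 04:28Z (lit-su gen 8).
-/

noncomputable section

open scoped Classical MatrixGroups ModularForm

open CongruenceSubgroup WeierstrassCurve Literature.NumberTheory.EllipticCurves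
  Literature.NumberTheory.EllipticCurves.ModularForms Literature.NumberTheory.EllipticCurves.Rank1Residual
  Literature.NumberTheory.EllipticCurves.Rank1Residual.Typed
  Literature.NumberTheory.EllipticCurves.Wuthrich2014
  Summit.BirchSwinnertonDyer.BirchSwinnertonDyer.Theorems.Rank1ResidualX1Defs

set_option autoImplicit false

namespace Summit.BirchSwinnertonDyer.Rank1Residual.X10

variable (W : WeierstrassCurve ℚ) [W.IsElliptic] [W.IsGloballyMinimal]

/-- **X10a′ ∩ {r = 0}: `MazurMainConjecture W 3 ↔ BSDp W 3`** — verbatim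
`X10.mazurMainConjecture_iff_bsdp_three` with the Lemma-20 binder DROPPED (`X10.towerSurj_of_surj`) and
Greenberg Thm. 4.1 taken from Schneider/BMS odd + MST σ odd (`greenberg_charValue_rankZero_of_Schneider1985_odd`).
[cite: Kato2004Asterisque, Thm. 17.4 (3) (p. 273)] [cite: GreenbergLNM1716, Thm. 4.1 and §5 (closing examples)]
[cite: BalakrishnanMullerStein2015, Thm. 1.7] [cite: Wuthrich2014, Lemma 20 (p. 400)] -/
theorem mazurMainConjecture_iff_bsdp_three_of_towerSurj (hS : Schneider1985_order_charGenerator_odd)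
    (hMT : mazur_tate_sigma_exists_odd)
    (hmod : nonempty_modularParametrizationData)
    (hGZK : rank_eq_analyticRank_of_analyticRank_le_one)
    (hK : ∀ (κ : ZpExtension ℚ 3) (γ : Field.absoluteGaloisGroup ℚ) [NeZero (W.conductorNorm ℤ)]
      (f : CuspForm (Gamma0 (W.conductorNorm ℤ)) 2), kato_divisibility W 3 (κ := κ) (γ := γ) (f := f))
    (hϖ : ∀ [NeZero (W.conductorNorm ℤ)] (f : CuspForm (Gamma0 (W.conductorNorm ℤ)) 2),
      IsNewformOf W f → ∀ ϖ : ℚ, (ϖ : ℝ) * W.realPeriodRat = plusPeriod f → padicValRat 3 ϖ = 0)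
    (hX : ClassX10 W 3) (hsurj : Surj W 3) (hr0 : W.analyticRank = 0) :
    MazurMainConjecture W 3 ↔ BSDp W 3 := by
  haveI : NeZero (W.conductorNorm ℤ) := ⟨(W.conductorNorm_pos_holds).ne'⟩
  obtain ⟨Dm⟩ := hmod W
  have hL : W.entireLFunction 1 ≠ 0 :=
    (W.analyticRank_eq_zero_iff_holds Dm.isNewformOf.hasEntireLFunction).mp hr0
  exact mainConjecture_iff_bsdp_of_kato W 3 (greenberg_charValue_rankZero_of_Schneider1985_odd hS hMT)
    hmod hGZK hK (by decide) hX.2.1.1 hX.2.1.2 (X10.towerSurj_of_surj W hX hsurj) hL hϖ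

/-- **X10a′ ∩ {r = 0}: `MazurMainConjecture W 3 ↔ Typed.MissingLowerBoundAt W 3`** — verbatim
`X10.mazurMainConjecture_iff_missingLowerBoundAt_three`, Lemma-20 binder dropped, Greenberg from
Schneider/BMS odd + MST σ odd. [cite: Kato2004Asterisque, Thm. 17.4 (3) (p. 273)]
[cite: GreenbergLNM1716, Thm. 4.1 and §5 (closing examples)] [cite: Wuthrich2014, Lemma 20 and Prop. 21 (p. 400)] -/
theorem mazurMainConjecture_iff_missingLowerBoundAt_three_of_towerSurj
    (hS : Schneider1985_order_charGenerator_odd) (hMT : mazur_tate_sigma_exists_odd)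
    (hmod : nonempty_modularParametrizationData)
    (hGZK : rank_eq_analyticRank_of_analyticRank_le_one)
    (hK : ∀ (κ : ZpExtension ℚ 3) (γ : Field.absoluteGaloisGroup ℚ) [NeZero (W.conductorNorm ℤ)]
      (f : CuspForm (Gamma0 (W.conductorNorm ℤ)) 2), kato_divisibility W 3 (κ := κ) (γ := γ) (f := f))
    (hϖ : ∀ [NeZero (W.conductorNorm ℤ)] (f : CuspForm (Gamma0 (W.conductorNorm ℤ)) 2),
      IsNewformOf W f → ∀ ϖ : ℚ, (ϖ : ℝ) * W.realPeriodRat = plusPeriod f → padicValRat 3 ϖ = 0)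
    (hX : ClassX10 W 3) (hsurj : Surj W 3) (hr0 : W.analyticRank = 0) :
    MazurMainConjecture W 3 ↔ MissingLowerBoundAt W 3 := by
  haveI : NeZero (W.conductorNorm ℤ) := ⟨(W.conductorNorm_pos_holds).ne'⟩
  obtain ⟨Dm⟩ := hmod W
  have hL : W.entireLFunction 1 ≠ 0 :=
    (W.analyticRank_eq_zero_iff_holds Dm.isNewformOf.hasEntireLFunction).mp hr0
  exact mainConjecture_iff_missingLowerBoundAt_of_kato W 3
    (greenberg_charValue_rankZero_of_Schneider1985_odd hS hMT) hmod hGZK hK (by decide) hX.2.1.1 hX.2.1.2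
    (X10.towerSurj_of_surj W hX hsurj) hL hϖ

/-- **Per pair, `3 ∤ #Ш_an` ⇒ `MazurMainConjecture W 3`** on X10a′ ∩ {r = 0} — verbatim
`X10.mazurMainConjecture_three_of_shaAn_unit`, Lemma-20 binder dropped, Greenberg from Schneider/BMS
odd + MST σ odd (lever L1 = Wuthrich Prop. 21 `hW`; analytic continuation `hmodL`).
[cite: Wuthrich2014, Prop. 21 and Lemma 20 (p. 400)] [cite: Kato2004Asterisque, Thm. 17.4 (3) (p. 273)]
[cite: GreenbergLNM1716, §5 (closing examples)] -/
theorem mazurMainConjecture_three_of_shaAn_unit_of_towerSurj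
    (hS : Schneider1985_order_charGenerator_odd) (hMT : mazur_tate_sigma_exists_odd)
    (hmod : nonempty_modularParametrizationData) (hmodL : hasEntireLFunction_rat)
    (hGZK : rank_eq_analyticRank_of_analyticRank_le_one) (hW : sha_dvd_analyticSha)
    (hK : ∀ (κ : ZpExtension ℚ 3) (γ : Field.absoluteGaloisGroup ℚ) [NeZero (W.conductorNorm ℤ)]
      (f : CuspForm (Gamma0 (W.conductorNorm ℤ)) 2), kato_divisibility W 3 (κ := κ) (γ := γ) (f := f))
    (hϖ : ∀ [NeZero (W.conductorNorm ℤ)] (f : CuspForm (Gamma0 (W.conductorNorm ℤ)) 2),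
      IsNewformOf W f → ∀ ϖ : ℚ, (ϖ : ℝ) * W.realPeriodRat = plusPeriod f → padicValRat 3 ϖ = 0)
    (hX : ClassX10 W 3) (hsurj : Surj W 3) (hr0 : W.analyticRank = 0)
    (hunit : ∃ q : ℚ, shaAn W = (q : ℂ) ∧ padicValRat 3 q = 0) : MazurMainConjecture W 3 :=
  (mazurMainConjecture_iff_bsdp_three_of_towerSurj W hS hMT hmod hGZK hK hϖ hX hsurj hr0).mpr
    (Typed.X10.bsdp_three_rankZero_surj_of_shaAn_unit hW hGZK hmodL W hX hr0 hsurj hunit)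

/-- **Per pair, `ord_3 #Ш_an ≤ 2` + a certificate `3 ∣ #Ш(E/ℚ)` ⇒ `MazurMainConjecture W 3`** on
X10a′ ∩ {r = 0} — verbatim `X10.mazurMainConjecture_three_of_casselsTate_of_three_dvd`, Lemma-20
binder dropped, Greenberg from Schneider/BMS odd + MST σ odd.
[cite: Wuthrich2014, Prop. 21 (p. 400)] [cite: SilvermanAEC2009, Thm. X.4.14]
[cite: Kato2004Asterisque, Thm. 17.4 (3) (p. 273)] -/
theorem mazurMainConjecture_three_of_casselsTate_of_three_dvd_of_towerSurj
    (hS : Schneider1985_order_charGenerator_odd) (hMT : mazur_tate_sigma_exists_odd)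
    (hmod : nonempty_modularParametrizationData) (hmodL : hasEntireLFunction_rat)
    (hGZK : rank_eq_analyticRank_of_analyticRank_le_one)
    (hCT : exists_casselsTate_pairing (K := ℚ)) (hW : sha_dvd_analyticSha)
    (hK : ∀ (κ : ZpExtension ℚ 3) (γ : Field.absoluteGaloisGroup ℚ) [NeZero (W.conductorNorm ℤ)]
      (f : CuspForm (Gamma0 (W.conductorNorm ℤ)) 2), kato_divisibility W 3 (κ := κ) (γ := γ) (f := f))
    (hϖ : ∀ [NeZero (W.conductorNorm ℤ)] (f : CuspForm (Gamma0 (W.conductorNorm ℤ)) 2),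
      IsNewformOf W f → ∀ ϖ : ℚ, (ϖ : ℝ) * W.realPeriodRat = plusPeriod f → padicValRat 3 ϖ = 0)
    (hX : ClassX10 W 3) (hsurj : Surj W 3) (hr0 : W.analyticRank = 0)
    {q : ℚ} (hq : shaAn W = (q : ℂ)) (hv : padicValRat 3 q ≤ 2) (hdvd : 3 ∣ W.shaOrder) :
    MazurMainConjecture W 3 :=
  (mazurMainConjecture_iff_bsdp_three_of_towerSurj W hS hMT hmod hGZK hK hϖ hX hsurj hr0).mpr
    (Typed.X10.bsdp_three_rankZero_surj_of_casselsTate_of_three_dvd hCT hW hGZK hmodL W hX hr0 hsurj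
      hq hv hdvd)

end Summit.BirchSwinnertonDyer.Rank1Residual.X10

end
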